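import Literature.Computability.Cryptography.UnitResidueWalk
import HarnessLib

/-!
# The unit-residue algorithm, IV: the binary ladder of levels

Topic `Computability/Cryptography`, continuing `UnitResidueWalk.lean`. To reach distance `≈ T` (the
target `T = r₂ - 4n` below `log₂ ε₀`) in polynomially many moves, the distance is doubled level by
level along the binary expansion of `T` (Jacobson–Williams §7.4, "compute `𝔟_{j+1} = 𝔟_j * 𝔟_j` until
… close to `E/2^k`"; §12.2, Alg. 12.6 CR): with `pref T l k = ⌊T/2^{l-k}⌋` (`pref T l l = T`,
`pref T l 0 = 1`, `2·pref k ≤ pref (k+1) ≤ 2·pref k + 1`), level `k` aims at the window just above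
`pref k - c₀`:

* `level lp k = gwalk (pref k - c₀) ∘ reduceF ∘ sqF` and `levels lp k₀ s` (levels `k₀+1, …, l`);
* the level invariant `LInv lp k s ε`: good state, accuracy `ε`, and
  `pref k - c₀ - 1/8 ≤ log₂|θ| ≤ pref k - c₀ + 1/8 + log₂ √Δ`;
* **`LInv.level`** — one level: `LInv k s ε → LInv (k+1) (level (k+1) s) (2ε + (6 + 10N)/2^P)`
  (squaring doubles the distance and the error; the reduction costs at most `log₂(2Δ²)`; the walk
  closes the gap of `≤ c₀ + 5n + 3` in at most `N` guarded steps), under `c₀ ≥ 2n + 1`,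
  `N ≥ 2c₀ + 10n + 8`, and the accuracy budget;
* **`LInv.levels`** — all levels by induction, with the geometric error recursion bounded by
  `2^{l+1} (ε₀ + C)`;
* `kz` — the first level whose prefix exceeds `c₀` (computed by a guarded counter, as the machine does)
  and its properties (`kz_spec`).

Everything is proved; no named facts.

## References

* M. J. Jacobson, Jr., H. C. Williams, *Solving the Pell Equation*, CMS Books in Mathematics, Springer
  (2009), §7.4 (baby-step giant-step to a prescribed distance), §12.2 (Alg. 12.6 CR: the doubling
  ladder `x_{i+1} = 2 x_i` with corrections). [JacobsonWilliams2008]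
-/

noncomputable section

open scoped Classical

namespace Literature.Computability.Cryptography.UnitResidue

open Literature.NumberTheory.QuadraticFields.Infra

/-! ### Binary prefixes of the target -/

/-- `pref T l k = ⌊T / 2^{l-k}⌋`, the first `k+1` bits of the `(l+1)`-bit target `T`.
[cite: JacobsonWilliams2008, §12.2 (Alg. 12.6, the binary expansion of x)] -/
def pref (T : ℤ) (l k : ℕ) : ℤ := T / 2 ^ (l - k)

/-- `pref T l l = T`. [folklore] -/
@[simp] theorem pref_self (T : ℤ) (l : ℕ) : pref T l l = T := by simp [pref]

/-- `pref (k+1) / 2 = pref k` for `k < l`. [folklore] -/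
theorem pref_succ_div (T : ℤ) {l k : ℕ} (hk : k < l) : pref T l (k + 1) / 2 = pref T l k := by
  unfold pref
  rw [Int.ediv_ediv_of_nonneg (by positivity), ← pow_succ]
  congr 2; omega

/-- `2 pref k ≤ pref (k+1) ≤ 2 pref k + 1` for `k < l` and `T ≥ 0`. [folklore] -/
theorem pref_succ_bounds {T : ℤ} (hT : 0 ≤ T) {l k : ℕ} (hk : k < l) :
    2 * pref T l k ≤ pref T l (k + 1) ∧ pref T l (k + 1) ≤ 2 * pref T l k + 1 := by
  have h := pref_succ_div T hk
  have h0 : 0 ≤ pref T l (k + 1) := Int.ediv_nonneg hT (by positivity)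
  rw [← h]
  omega

/-- `pref` is monotone in `k ≤ l` for `T ≥ 0`. [folklore] -/
theorem pref_mono {T : ℤ} (hT : 0 ≤ T) {l : ℕ} {j k : ℕ} (hjk : j ≤ k) (hk : k ≤ l) : pref T l j ≤ pref T l k := by
  induction k, hjk using Nat.le_induction with
  | base => exact le_refl _
  | succ k' hle ih =>
    have := (pref_succ_bounds hT (show k' < l by omega)).1
    have h0 : 0 ≤ pref T l k' := Int.ediv_nonneg hT (by positivity)
    have := ih (by omega)
    linarith

/-- `pref T l 0 = 1` when `2^l ≤ T < 2^{l+1}`. [folklore] -/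
theorem pref_zero {T : ℤ} {l : ℕ} (h1 : (2 : ℤ) ^ l ≤ T) (h2 : T < 2 ^ (l + 1)) : pref T l 0 = 1 := by
  unfold pref
  rw [Nat.sub_zero]
  apply le_antisymm
  · have : T / 2 ^ l < 2 := Int.ediv_lt_of_lt_mul (by positivity) (by rw [pow_succ] at h2; linarith)
    omega
  · exact Int.le_ediv_of_mul_le (by positivity) (by linarith)

/-! ### The first useful level -/

/-- **The first level whose prefix exceeds `V - 1`**, computed by a guarded counter:
`k ↦ k + 1` while `pref k < V` and `k < l`, `N` rounds. [folklore] -/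
def kz (T : ℤ) (l : ℕ) (V : ℤ) (N : ℕ) : ℕ := (fun k => if pref T l k < V ∧ k < l then k + 1 else k)^[N] 0

/-- **Properties of `kz`**: if `pref 0 < V ≤ pref l` and `N ≥ l` then `1 ≤ kz ≤ l`, `V ≤ pref kz` and
`pref kz ≤ 2V - 1`. [folklore] -/
theorem kz_spec {T : ℤ} (hT : 0 ≤ T) {l : ℕ} {V : ℤ} {N : ℕ} (h0 : pref T l 0 < V) (hl : V ≤ pref T l l)
    (hN : l ≤ N) :
    1 ≤ kz T l V N ∧ kz T l V N ≤ l ∧ V ≤ pref T l (kz T l V N) ∧ pref T l (kz T l V N) ≤ 2 * V - 1 := by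
  have hex : ∃ k, ¬ (pref T l k < V ∧ k < l) := ⟨l, by omega⟩
  set J := Nat.find hex with hJ
  have hJspec : ¬ (pref T l J < V ∧ J < l) := Nat.find_spec hex
  have hJmin : ∀ j, j < J → pref T l j < V ∧ j < l := fun j hj => by
    have := Nat.find_min hex hj; push Not at this; exact ⟨this.1, this.2⟩
  have hiter : ∀ j, (fun k => k + 1)^[j] 0 = j := by
    intro j; induction j with
    | zero => rfl
    | succ j ih => rw [Function.iterate_succ_apply', ih]
  have heq : kz T l V N = min N J := by
    unfold kz
    have := iterate_guard (fun k => k + 1) (fun k => pref T l k < V ∧ k < l) 0 (J := J)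
      (by rw [hiter]; exact hJspec) (fun j hj => by rw [hiter]; exact hJmin j hj) N
    rw [hiter] at this
    exact this
  have hJl : J ≤ l := by
    by_contra hcon; push Not at hcon
    have := (hJmin l hcon).2; omega
  have hJ1 : 1 ≤ J := by
    by_contra hcon
    have hJ0 : J = 0 := by omega
    rw [hJ0] at hJspec
    push Not at hJspec
    have := hJspec h0
    have : l = 0 := by omega
    subst this
    simp at hl h0; linarith
  rw [heq, min_eq_right (by omega)]
  have hpJ : V ≤ pref T l J := by
    by_contra hcon; push Not at hcon
    rcases lt_or_eq_of_le hJl with hlt | heq'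
    · exact hJspec ⟨hcon, hlt⟩
    · rw [heq'] at hcon; linarith
  refine ⟨hJ1, hJl, hpJ, ?_⟩
  obtain ⟨J', hJ'⟩ : ∃ J', J = J' + 1 := ⟨J - 1, by omega⟩
  have hprev := (hJmin J' (by omega)).1
  have hb := (pref_succ_bounds hT (show J' < l by omega)).2
  rw [hJ'] at *
  linarith

/-! ### Levels -/

/-- Parameters of the ladder: static data, fuel per phase, slack `c₀`, target `T`, top level `l`,
and the size bound `n` (`log₂ √Δ < n`). [cite: JacobsonWilliams2008, §12.2] -/
structure LP where
  /-- static data -/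
  pm : Prm
  /-- fuel of every guarded loop -/
  N : ℕ
  /-- window slack -/
  c₀ : ℕ
  /-- the target distance (in `log₂` units) -/
  T : ℤ
  /-- the top level: `2^l ≤ T < 2^{l+1}` -/
  l : ℕ
  /-- a bound on `log₂ Δ` -/
  n : ℕ

/-- Validity of the ladder parameters. [folklore] -/
structure LP.OK (lp : LP) : Prop where
  pm : lp.pm.OK
  T_pos : 1 ≤ lp.T
  l_def : (2 : ℤ) ^ lp.l ≤ lp.T ∧ lp.T < 2 ^ (lp.l + 1)
  n_rt : Real.logb 2 (rt lp.pm.Δ) < lp.n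
  n_Δ : lp.pm.Δ < 2 ^ lp.n
  c₀_large : 2 * lp.n + 1 ≤ lp.c₀
  N_large : 2 * lp.c₀ + 12 * lp.n + 12 ≤ lp.N
  N_red : lp.n + 1 ≤ lp.N
  N_A : 4 * lp.c₀ + 4 ≤ lp.N

variable {lp : LP}

/-- `1 ≤ √Δ`, hence `0 ≤ log₂ √Δ`. [folklore] -/
theorem logb_rt_nonneg {pm : Prm} (h : pm.OK) : 0 ≤ Real.logb 2 (rt pm.Δ) := by
  apply Real.logb_nonneg (by norm_num)
  unfold rt
  rw [Real.one_le_sqrt]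
  exact_mod_cast h.disc.one_le

/-- One level: giant step, reduction, guarded walk to the window above `pref k - c₀`.
[cite: JacobsonWilliams2008, §12.2 (Alg. 12.6, one round), §7.4] -/
def level (lp : LP) (k : ℕ) (s : AS) : AS :=
  gwalk lp.pm (pref lp.T lp.l k - lp.c₀) lp.N (reduceF lp.pm (sqF lp.pm lp.N s) lp.N)

/-- The levels `k₀ + 1, …, k₀ + j` applied in order. [cite: JacobsonWilliams2008, §12.2 (Alg. 12.6)] -/
def levels (lp : LP) (k₀ : ℕ) : ℕ → AS → AS
  | 0, s => s
  | j + 1, s => level lp (k₀ + j + 1) (levels lp k₀ j s)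

/-- **The level invariant**: good state at accuracy `ε` with `log₂|θ|` in the window above
`pref k - c₀`. [cite: JacobsonWilliams2008, §12.2 (the invariant |x_i - log₂ θ_i| of CR)] -/
structure LInv (lp : LP) (k : ℕ) (s : AS) (ε : ℝ) : Prop where
  good : Good lp.pm s ε
  lo : (pref lp.T lp.l k : ℝ) - lp.c₀ - 1 / 8 ≤ Real.logb 2 |ev lp.pm.Δ (rt lp.pm.Δ) s.fr.p|
  hi : Real.logb 2 |ev lp.pm.Δ (rt lp.pm.Δ) s.fr.p| ≤ (pref lp.T lp.l k : ℝ) - lp.c₀ + 1 / 8 + Real.logb 2 (rt lp.pm.Δ)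

/-- The error added by one level. [folklore] -/
def LP.C (lp : LP) : ℝ := (6 + 10 * lp.N) / (2 : ℝ) ^ lp.pm.P

/-- **One level preserves the invariant** with error `ε ↦ 2ε + C`.
[cite: JacobsonWilliams2008, §12.2 (Alg. 12.6 CR), §7.4] -/
theorem LInv.level_step (h : lp.OK) {k : ℕ} {s : AS} {ε : ℝ} (hL : LInv lp k s ε) (hk : k < lp.l)
    (hε : 2 * ε + lp.C ≤ 1 / 8) :
    LInv lp (k + 1) (level lp (k + 1) s) (2 * ε + lp.C) := by
  show LInv lp (k + 1) (gwalk lp.pm (pref lp.T lp.l (k + 1) - lp.c₀) lp.N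
    (reduceF lp.pm (sqF lp.pm lp.N s) lp.N)) _
  have hpm := h.pm
  have hg := hL.good
  have hI := hg.inv
  have hR := hg.red
  have hP : (0 : ℝ) < (2 : ℝ) ^ lp.pm.P := by positivity
  have h5 : (0 : ℝ) ≤ 5 / (2 : ℝ) ^ lp.pm.P := by positivity
  -- accuracies of the three phases
  set ε₁ := 2 * ε + 6 / (2 : ℝ) ^ lp.pm.P with hε₁
  set ε₂ := ε₁ + lp.N * (5 / (2 : ℝ) ^ lp.pm.P) with hε₂
  set ε₃ := ε₂ + lp.N * (5 / (2 : ℝ) ^ lp.pm.P) with hε₃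
  have hC : ε₃ = 2 * ε + lp.C := by rw [hε₃, hε₂, hε₁]; unfold LP.C; field_simp; ring
  -- the giant step
  obtain ⟨hGI, hev, hAlt⟩ := hg.sqF_spec hpm (fuel := lp.N) (by
    have := h.N_large; have := h.c₀_large
    have : Nat.size lp.pm.Δ ≤ lp.n := Nat.size_le.mpr h.n_Δ
    omega)
  set s₁ := sqF lp.pm lp.N s with hs₁
  -- the reduction
  have hL4 : s₁.fr.a < 4 ^ lp.n := by
    have h1 : (s₁.fr.a : ℤ) < lp.pm.Δ := hAlt
    have h2 : lp.pm.Δ < 4 ^ lp.n := lt_of_lt_of_le h.n_Δ (Nat.pow_le_pow_left (by norm_num) _)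
    omega
  obtain ⟨hg₂, hle₂, hge₂⟩ := hGI.reduceF_spec hpm hAlt hL4 h.N_red
  set s₂ := reduceF lp.pm s₁ lp.N with hs₂
  -- distances in `log₂`
  set L₀ := Real.logb 2 |ev lp.pm.Δ (rt lp.pm.Δ) s.fr.p| with hL₀
  set L₂ := Real.logb 2 |ev lp.pm.Δ (rt lp.pm.Δ) s₂.fr.p| with hL₂def
  set Lr := Real.logb 2 (rt lp.pm.Δ) with hLr
  have hθ0 : 0 < |ev lp.pm.Δ (rt lp.pm.Δ) s.fr.p| := abs_pos.mpr (hI.ev_p_ne_zero hpm.disc)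
  have hθ2 : 0 < |ev lp.pm.Δ (rt lp.pm.Δ) s₂.fr.p| := abs_pos.mpr (hg₂.inv.ev_p_ne_zero hpm.disc)
  have hθ1 : 0 < |ev lp.pm.Δ (rt lp.pm.Δ) s₁.fr.p| := by
    by_contra hcon; push Not at hcon
    have : |ev lp.pm.Δ (rt lp.pm.Δ) s₁.fr.p| = 0 := le_antisymm hcon (abs_nonneg _)
    rw [this] at hge₂
    have : |ev lp.pm.Δ (rt lp.pm.Δ) s₂.fr.p| ≤ 0 := by simpa using hle₂.trans (le_of_eq this)
    linarith
  have hg1 : (1 : ℝ) ≤ s.fr.g := by exact_mod_cast hI.g_pos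
  have hgs : (s.fr.g : ℝ) < rt lp.pm.Δ := by
    have h1 : (s.fr.g : ℤ) ≤ s.fr.a := by
      have := hI.a_eq; have := hI.a1_pos; nlinarith
    have h2 : (s.fr.g : ℝ) ≤ s.fr.a := by exact_mod_cast h1
    exact lt_of_le_of_lt h2 hR.a_lt_rt
  -- `log₂ |θ₁| = 2 L₀ - log₂ g`
  have hL1 : Real.logb 2 |ev lp.pm.Δ (rt lp.pm.Δ) s₁.fr.p| = 2 * L₀ - Real.logb 2 s.fr.g := by
    have e : |ev lp.pm.Δ (rt lp.pm.Δ) s₁.fr.p| = |ev lp.pm.Δ (rt lp.pm.Δ) s.fr.p| ^ 2 / s.fr.g := by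
      rw [eq_div_iff (by positivity), ← abs_pow, ← hev, abs_mul, abs_of_pos (by positivity : (0:ℝ) < s.fr.g), mul_comm]
    rw [e, Real.logb_div (pow_pos hθ0 2).ne' (by linarith : (0:ℝ) < s.fr.g).ne', Real.logb_pow]
    push_cast; ring
  have hlogg : 0 ≤ Real.logb 2 (s.fr.g : ℝ) ∧ Real.logb 2 (s.fr.g : ℝ) < Lr :=
    ⟨Real.logb_nonneg (by norm_num) hg1, Real.logb_lt_logb (by norm_num) (by positivity) hgs⟩
  -- the reduction correction: `L₁ - log₂(2 Δ a₁) ≤ L₂ ≤ L₁`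
  have hcorr : Real.logb 2 |ev lp.pm.Δ (rt lp.pm.Δ) s₁.fr.p| - (1 + 4 * Lr) ≤ L₂ ∧
      L₂ ≤ Real.logb 2 |ev lp.pm.Δ (rt lp.pm.Δ) s₁.fr.p| := by
    constructor
    · have ha1 : (1 : ℝ) ≤ s₁.fr.a := by exact_mod_cast hGI.inv.1
      have hfac : (1 : ℝ) ≤ 2 * lp.pm.Δ * s₁.fr.a := by
        have : (1 : ℝ) ≤ lp.pm.Δ := by exact_mod_cast hpm.disc.one_le
        nlinarith
      have := Real.logb_le_logb_of_le (b := 2) (by norm_num) hθ1 hge₂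
      have hΔ0 : (lp.pm.Δ : ℝ) ≠ 0 := by
        have : (1 : ℝ) ≤ lp.pm.Δ := by exact_mod_cast hpm.disc.one_le
        linarith
      have ha10 : (s₁.fr.a : ℝ) ≠ 0 := by linarith
      have h2Δ : (2 : ℝ) * lp.pm.Δ ≠ 0 := mul_ne_zero (by norm_num) hΔ0
      rw [Real.logb_mul (mul_ne_zero h2Δ ha10) hθ2.ne', Real.logb_mul h2Δ ha10,
        Real.logb_mul (by norm_num) hΔ0, Real.logb_self_eq_one (by norm_num)] at this
      -- `log₂ Δ = 2 Lr`, `log₂ a₁ < log₂ Δ`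
      have hΔ : Real.logb 2 (lp.pm.Δ : ℝ) = 2 * Lr := by
        rw [hLr, show (lp.pm.Δ : ℝ) = rt lp.pm.Δ ^ 2 from (rt_sq _).symm, Real.logb_pow]; push_cast; ring
      have ha : Real.logb 2 (s₁.fr.a : ℝ) ≤ 2 * Lr := by
        rw [← hΔ]; exact Real.logb_le_logb_of_le (by norm_num) (by positivity) (by exact_mod_cast hAlt.le)
      linarith
    · exact Real.logb_le_logb_of_le (by norm_num) hθ2 hle₂
  -- prefixes
  obtain ⟨hp1, hp2⟩ := pref_succ_bounds (T := lp.T) (by linarith [h.T_pos]) hk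
  have hp1' : (2 * pref lp.T lp.l k : ℝ) ≤ pref lp.T lp.l (k + 1) := by exact_mod_cast hp1
  have hp2' : (pref lp.T lp.l (k + 1) : ℝ) ≤ 2 * pref lp.T lp.l k + 1 := by exact_mod_cast hp2
  have hc₀ : (2 * lp.n + 1 : ℝ) ≤ lp.c₀ := by exact_mod_cast h.c₀_large
  have hn := h.n_rt
  rw [← hLr] at hn
  -- bounds on `L₂` relative to the new target `tgt = pref (k+1) - c₀`
  set tgt : ℤ := pref lp.T lp.l (k + 1) - lp.c₀ with htgt
  have hlo₀ := hL.lo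
  have hhi₀ := hL.hi
  rw [← hL₀] at hlo₀ hhi₀
  have hL2hi : L₂ ≤ (tgt : ℝ) := by
    rw [htgt]; push_cast
    have := hcorr.2
    rw [hL1] at this
    nlinarith [hlogg.1]
  have hL2lo : (tgt : ℝ) - ((lp.c₀ + 5 * lp.n + 3 : ℕ) : ℝ) ≤ L₂ := by
    rw [htgt]; push_cast
    have := hcorr.1
    rw [hL1] at this
    nlinarith [hlogg.2]
  -- the walk
  have hfuel : 2 * (lp.c₀ + 5 * lp.n + 3) + 2 ≤ lp.N := by have := h.N_large; omega
  have hbudget : ε₂ + lp.N * (5 / (2 : ℝ) ^ lp.pm.P) ≤ 1 / 8 := by rw [← hε₃, hC]; exact hε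
  obtain ⟨hg₃, _, hlo₃, hhi₃, _⟩ := hg₂.gwalk_window hpm (tgt := tgt) hL2lo hfuel hbudget
  rw [← hε₃] at hg₃
  rw [hC] at hg₃
  have htgtR : (tgt : ℝ) = pref lp.T lp.l (k + 1) - lp.c₀ := by rw [htgt]; push_cast; ring
  have hLr0 : 0 ≤ Lr := by rw [hLr]; exact logb_rt_nonneg hpm
  have hlo' : (pref lp.T lp.l (k + 1) : ℝ) - lp.c₀ - 1 / 8 ≤
      Real.logb 2 |ev lp.pm.Δ (rt lp.pm.Δ) (gwalk lp.pm tgt lp.N s₂).fr.p| := by linarith [hlo₃, htgtR]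
  have hhi' : Real.logb 2 |ev lp.pm.Δ (rt lp.pm.Δ) (gwalk lp.pm tgt lp.N s₂).fr.p| ≤
      (pref lp.T lp.l (k + 1) : ℝ) - lp.c₀ + 1 / 8 + Lr := by
    refine hhi₃.trans (max_le ?_ ?_)
    · linarith [hL2hi, htgtR, hLr0, hL₂def, hLr]
    · linarith [htgtR, hLr]
  exact LInv.mk hg₃ hlo' hhi'

/-- **All levels**: from `LInv k₀ s ε₀`, after `j ≤ l - k₀` levels the invariant holds at level
`k₀ + j` with error at most `2^j (ε₀ + C)`, provided `2^{l+1}(ε₀ + C) ≤ 1/8`.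
[cite: JacobsonWilliams2008, §12.2 (Alg. 12.6 CR)] -/
theorem LInv.levels_spec (h : lp.OK) {k₀ : ℕ} {s : AS} {ε₀ : ℝ} (hL : LInv lp k₀ s ε₀) (hε0 : 0 ≤ ε₀)
    (hbudget : (2 : ℝ) ^ (lp.l + 1) * (ε₀ + lp.C) ≤ 1 / 8) :
    ∀ j, k₀ + j ≤ lp.l → ∃ ε, ε ≤ (2 : ℝ) ^ j * (ε₀ + lp.C) - lp.C ∧ LInv lp (k₀ + j) (levels lp k₀ j s) ε := by
  have hC0 : 0 ≤ lp.C := by unfold LP.C; positivity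
  intro j
  induction j with
  | zero => intro _; exact ⟨ε₀, by simp, hL⟩
  | succ j ih =>
    intro hj
    obtain ⟨ε, hεle, hLj⟩ := ih (by omega)
    have hεnn : 0 ≤ ε := by
      have := hLj.good.acc.2.2; exact (abs_nonneg _).trans this
    have hpow : (2 : ℝ) ^ (j + 1) ≤ (2 : ℝ) ^ (lp.l + 1) := pow_le_pow_right₀ (by norm_num) (by omega)
    have hnext : 2 * ε + lp.C ≤ (2 : ℝ) ^ (j + 1) * (ε₀ + lp.C) - lp.C := by
      rw [pow_succ]; nlinarith
    have hε' : 2 * ε + lp.C ≤ 1 / 8 := by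
      have : (0:ℝ) ≤ ε₀ + lp.C := by linarith
      nlinarith
    refine ⟨2 * ε + lp.C, hnext, ?_⟩
    show LInv lp (k₀ + (j + 1)) (UnitResidue.level lp (k₀ + j + 1) (UnitResidue.levels lp k₀ j s)) _
    rw [show k₀ + (j + 1) = (k₀ + j) + 1 by ring]
    exact hLj.level_step h (by omega) hε'

end Literature.Computability.Cryptography.UnitResidue

end
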